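import Literature.MathematicalPhysics.QuantumFieldTheory.Dimock2015.AnalyticLipschitz
import Literature.MathematicalPhysics.QuantumFieldTheory.Balaban1983to89.T4HistoryLipschitzRecursion

/-!
# T4HistoryLipschitzOuter (v1.2) — the outer constant of the NE9 step inequality: `OuterLipschitz` = (explicit last-coupling
modulus) + (Lipschitz dependence of the new term on the channel outputs), and the second half FROM ANALYTICITY on weighted
polydiscs by the Cauchy bound (cell `pub-balaban`, T4-DAG §2 node U3 / §5 row T4-U3.E / §6 NE9; seat NE9-P2, GAPS G-ne9p2-5)

HONEST FRAMING (T4-DAG PAGE 1).  Rung (B)+1 on a FIXED finite torus — NOT infinite volume, NOT a mass gap, NOT the Clay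
problem — and NOT a proof of NE9 for Bałaban's terms.  `T4HistoryLipschitzRecursion` (§6, v1.1) reduced the unprinted
one-step history-Lipschitz inequality `StepLipschitz` to an additive-channel size bound `ChannelSize` and ONE outer binder
`OuterLipschitz E W T κ wt lam cΦ` (NOT PRINTED in [Balaban1987RG1] / [Balaban1988RG2Cluster]: the term created at step
k + 1 depends majorant-Lipschitz on (g_k, channel outputs)).  This leaf does two pieces of bookkeeping on that binder and
asserts nothing about [I]–[III]:
(§1) FACTORISATION: if the new term is a function `Ψ k (g k) (T k g (E g))` of the explicit last coupling and of the
channel outputs ((2.13) p. 268 of [Balaban1987RG1]: `𝐄^{(k+1)}(g_k, U_{k+1}) = log ∫ dμ χ_k exp[𝐏^{(k)}(g_k, U_{k+1}, B)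
+ {...}]` with the bracket = the channel output, [Balaban1988RG2Cluster] Lemma 1 (1.33) p. 9), then `OuterLipschitz` splits
by ONE triangle inequality into an explicit-coupling modulus `lam k` (binder `LastCouplingLipschitz`) and a Lipschitz
modulus `cΦ k` of `Ψ k s` in the outputs, in the weighted-majorant form `(∀ y, |P y − P′ y| ≤ wt k y·M) → |Ψ P − Ψ P′| ≤
e^{−κd}·cΦ k·M` (binder `OutputLipschitz`) — `outerLipschitz_of_factorisation`.
(§2) THE WEIGHTED CAUCHY BOUND [folklore; kernel from the tree lemma `Dimock2015.norm_sub_le_of_margin`]: a map `A` on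
`ι → ℂ` (ι finite), complex differentiable with `‖A‖ ≤ B` on a set containing the WEIGHTED closed polydisc
`{Q | ∀ i, ‖Q i − P i‖ ≤ w i·ϱ}` about every point `P` of a comparison set `S` (weights `w i > 0`, margin `ϱ > 0`), satisfies
`‖A P − A P′‖ ≤ (4B/ϱ)·M` for `P, P′ ∈ S` with `‖P i − P′ i‖ ≤ w i·M` — `weightedCauchyLipschitz` (rescale by the weights;
sup norm).  (§3) Hence `OutputLipschitz` with `cΦ k = 4·B₀ k/ϱ` for a new-term map that is (the real part of) a
complex-analytic function of the outputs, bounded by `B₀ k·e^{−κ d(X)}` on the weighted polydiscs of margin ϱ about every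
output configuration `T k g′ (E g)` that occurs (g, g′ ∈ W — INCLUDING the hybrid points g ≠ g′: channel at coupling g′ on
the terms of the history g) — `outputLipschitz_of_analytic`, and the composed `outerLipschitz_of_analytic`.
(§4, v1.1) THE BANACH FORM, ANY OUTPUT INDEX: Bałaban's channel outputs are indexed by `y ↔ (Y, U_{k+1}, B)` with U, B
ranging over field configurations — an INFINITE index even on a finite lattice — so the finite-ι sup-norm form of §2–§3 is the
discretised / toy case.  §4 removes `[Fintype ι]`: the output configuration is read into ANY complex normed space `Pot` (the
intended instance: a weighted sup-norm space of potentials) by a map `ρ k` whose distances are dominated by the weighted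
majorant (`‖ρ k P − ρ k P′‖ ≤ M` whenever `∀ y, |P y − P′ y| ≤ wt k y·M`), the new-term map is the real part of a complex
differentiable `A k s U X` on a set containing the closed ϱ-ball about every occurring `ρ k (T k g′ (E g))`, bounded by
`B₀ k·e^{−κd(X)}` — then `OutputLipschitz … (fun k => 4·B₀ k/ϱ)` by `Dimock2015.norm_sub_le_of_margin` directly
(`outputLipschitz_of_analyticOn_banach`, `outerLipschitz_of_analyticOn_banach`); no nonemptiness or finiteness needed.
(§5, v1.2) THE MAXIMAL MARGIN: with the analyticity set a closed ball of radius `R` about the ORIGIN of `Pot` and all occurring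
output configurations (hybrid ones included) of norm `≤ s < R`, the margin `R − s` is available and the outer constant is
`4·B₀ k/(R − s)` (`outputLipschitz_of_analyticOn_ball`, `outerLipschitz_of_analyticOn_ball`); the two NE9 smallness
conditions of `T4HistoryLipschitzRecursion` then become LOWER BOUNDS ON THE ANALYTICITY RADIUS in units of the channel
weight: fading memory (§6 there, rate `ω + c̄τ̄`) ⟸ `4B₀τ̄ < (R − s)(1 − ω)` (`fade_of_radius`), bounded moduli (§7 there,
v1.2, `K = c̄τu ≤ 1`) ⟸ `4B₀τu ≤ R − s` (`nonexpansive_of_radius`) — conditions of the printed TYPE «ε₁ sufficiently small»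
(p. 18 of [Balaban1988RG2Cluster]) under the cell's reading of the units, NOT printed inequalities (GAPS G-ne9p2-3).
WHAT THIS MOVES (GAPS G-ne9p2-5): the outer constant is no longer a free «Lipschitz» binder but follows from a binder of the
TYPE Bałaban prints everywhere — ANALYTICITY + SIZE on a complex domain with a margin ([Balaban1988RG2Cluster] (2.14)–(2.15)
p. 15 «We consider it as an analytic function of (U,J) in the space U^c_{k+1}(X,α₀,α₁), and of the complex parameters σ(Z),
τ.», the α₆-extraction p. 18, (2.35) p. 19).  What is STILL NOT PRINTED: analyticity of the new term in the channel
outputs {V′_k(Y)}_Y AS INDEPENDENT VARIABLES on a weighted polydisc (print: analyticity in (U, J, σ, τ) — the potentials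
are functions of U there), i.e. the hypotheses `hA`/`hB`/`hS` of §3 for Bałaban's objects; recorded as the cell's reading,
not as a fact.  The activity → output half alone is in the tree for the polymer-log carriers
(`T4ActivityLipschitz.norm_locE_sub_locE_le_of_small`), by name; nothing of it is imported here.
Conditionals BetaPertH, (B), (B^μ) do not occur in this module.  Value = typed reduction + kernel Cauchy bookkeeping; NOT
summit progress.
-/

noncomputable section

namespace Literature.MathematicalPhysics.QuantumFieldTheory.Balaban1983to89.T4HistoryLipschitzOuter

open scoped BigOperators
open Metric Set
open Literature.MathematicalPhysics.QuantumFieldTheory.Balaban1983to89.T4OutputRate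
open Literature.MathematicalPhysics.QuantumFieldTheory.Balaban1983to89.T4HistoryLipschitzRecursion
open Literature.MathematicalPhysics.QuantumFieldTheory.Dimock2015

variable {C : Carriers}

/-! ## §1 Factorisation of the outer binder -/

/-- SHAPE (printed STRUCTURE, typed as a binder): on scale-(k+1) domains the new term is a function `Ψ k s P` of the explicit
last coupling `s = g k` and of the channel outputs `P = T k g (E g)` ([Balaban1987RG1] (2.13) p. 268; [Balaban1988RG2Cluster]
(1.33) p. 9). [cite: Balaban1987RG1, (2.13) p.268] -/
def Factorises {Bg ι : Type} (E : Functional C Bg) (W : Set (ℕ → ℝ)) (T : ℕ → (ℕ → ℝ) → (Bg → C.Dom → ℝ) → ι → ℝ)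
    (Ψ : ℕ → ℝ → (ι → ℝ) → Bg → C.Dom → ℝ) : Prop :=
  ∀ g ∈ W, ∀ (k : ℕ) (U : Bg) (X : C.Dom), C.scale X = k + 1 → E g U X = Ψ k (g k) (T k g (E g)) U X

/-- SHAPE (binder, NOT PRINTED as an inequality; print: the new term is «a C^∞-function of g_{j−1} ∈ [0, γ], (or analytic)»,
[Balaban1987RG1] p. 263): the EXPLICIT last-coupling dependence — through `s = g k` in `Ψ k s` AND through the channel's own
coupling argument `T k g` on the SAME old terms — has modulus `lam k`. [cite: Balaban1987RG1, p.263 (1.18)] -/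
def LastCouplingLipschitz {Bg ι : Type} (E : Functional C Bg) (W : Set (ℕ → ℝ))
    (T : ℕ → (ℕ → ℝ) → (Bg → C.Dom → ℝ) → ι → ℝ) (Ψ : ℕ → ℝ → (ι → ℝ) → Bg → C.Dom → ℝ) (κ : ℝ) (lam : ℕ → ℝ) :
    Prop :=
  ∀ g ∈ W, ∀ g' ∈ W, ∀ (k : ℕ) (U : Bg) (X : C.Dom), C.scale X = k + 1 →
    |Ψ k (g k) (T k g (E g)) U X - Ψ k (g' k) (T k g' (E g)) U X| ≤ Real.exp (-(κ * C.d X)) * (lam k * |g k - g' k|)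

/-- SHAPE (binder, NOT PRINTED: GAPS G-ne9p2-5): Lipschitz dependence of the new-term map on the channel outputs in the
weighted-majorant form, at every coupling value that occurs and between the two output configurations that occur in
`OuterLipschitz` (channel at coupling g′ on the terms of g and of g′). [cite: Balaban1988RG2Cluster, (2.14)-(2.15) p.15] -/
def OutputLipschitz {Bg ι : Type} (E : Functional C Bg) (W : Set (ℕ → ℝ))
    (T : ℕ → (ℕ → ℝ) → (Bg → C.Dom → ℝ) → ι → ℝ) (Ψ : ℕ → ℝ → (ι → ℝ) → Bg → C.Dom → ℝ) (κ : ℝ)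
    (wt : ℕ → ι → ℝ) (cΦ : ℕ → ℝ) : Prop :=
  ∀ g ∈ W, ∀ g' ∈ W, ∀ (k : ℕ) (M : ℝ),
    (∀ y : ι, |T k g' (E g) y - T k g' (E g') y| ≤ wt k y * M) →
      ∀ (U : Bg) (X : C.Dom), C.scale X = k + 1 →
        |Ψ k (g' k) (T k g' (E g)) U X - Ψ k (g' k) (T k g' (E g')) U X| ≤ Real.exp (-(κ * C.d X)) * (cΦ k * M)

/-- **`OuterLipschitz` = last-coupling modulus + output modulus** (one triangle inequality). [folklore] -/
theorem outerLipschitz_of_factorisation {Bg ι : Type} {E : Functional C Bg} {W : Set (ℕ → ℝ)}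
    {T : ℕ → (ℕ → ℝ) → (Bg → C.Dom → ℝ) → ι → ℝ} {Ψ : ℕ → ℝ → (ι → ℝ) → Bg → C.Dom → ℝ} {κ : ℝ}
    {wt : ℕ → ι → ℝ} {lam cΦ : ℕ → ℝ} (hfac : Factorises E W T Ψ) (hlast : LastCouplingLipschitz E W T Ψ κ lam)
    (hout : OutputLipschitz E W T Ψ κ wt cΦ) : OuterLipschitz E W T κ wt lam cΦ := by
  intro g hg g' hg' k M hM U X hX
  rw [hfac g hg k U X hX, hfac g' hg' k U X hX]
  have h1 := hlast g hg g' hg' k U X hX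
  have h2 := hout g hg g' hg' k M hM U X hX
  calc |Ψ k (g k) (T k g (E g)) U X - Ψ k (g' k) (T k g' (E g')) U X|
      ≤ |Ψ k (g k) (T k g (E g)) U X - Ψ k (g' k) (T k g' (E g)) U X| +
          |Ψ k (g' k) (T k g' (E g)) U X - Ψ k (g' k) (T k g' (E g')) U X| := abs_sub_le _ _ _
    _ ≤ Real.exp (-(κ * C.d X)) * (lam k * |g k - g' k|) + Real.exp (-(κ * C.d X)) * (cΦ k * M) :=
          add_le_add h1 h2
    _ = Real.exp (-(κ * C.d X)) * (lam k * |g k - g' k| + cΦ k * M) := by ring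

/-! ## §2 The weighted Cauchy bound (ι finite, values in a complex Banach space) -/

section WeightedCauchy

variable {ι : Type*} [Fintype ι] {F : Type*} [NormedAddCommGroup F] [NormedSpace ℂ F] [CompleteSpace F]

/-- Rescaling by positive weights: `wscale w v = (w i · v i)_i`. [folklore] -/
def wscale (w : ι → ℝ) (v : ι → ℂ) : ι → ℂ := fun i => (w i : ℂ) * v i

/-- The weighted closed polydisc of margin `ϱ` about `P`: `{Q | ∀ i, ‖Q i − P i‖ ≤ w i·ϱ}`. [folklore] -/
def WPolydisc (w : ι → ℝ) (P : ι → ℂ) (ϱ : ℝ) : Set (ι → ℂ) := {Q | ∀ i, ‖Q i - P i‖ ≤ w i * ϱ}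

/-- The weight rescaling is complex differentiable (it is ℂ-linear). [folklore] -/
theorem differentiable_wscale (w : ι → ℝ) : Differentiable ℂ (wscale w) := by
  unfold wscale
  fun_prop

omit [Fintype ι] in
/-- Unscaling then rescaling by positive weights is the identity. [folklore] -/
theorem wscale_unscale {w : ι → ℝ} (hw : ∀ i, 0 < w i) (P : ι → ℂ) :
    wscale w (fun i => P i / w i) = P := by
  funext i
  have hne : (w i : ℂ) ≠ 0 := by exact_mod_cast (hw i).ne'
  simp only [wscale]
  field_simp

/-- **WEIGHTED CAUCHY–LIPSCHITZ BOUND** (from the tree lemma `Dimock2015.norm_sub_le_of_margin` after rescaling by the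
weights): `A` complex differentiable with `‖A‖ ≤ B` on `Dset ⊇` every weighted polydisc of margin `ϱ` about the points of
`S`; then for `P, P′ ∈ S` with `‖P i − P′ i‖ ≤ w i·M` (`M ≥ 0`), `‖A P − A P′‖ ≤ (4B/ϱ)·M`. [folklore] -/
theorem weightedCauchyLipschitz {A : (ι → ℂ) → F} {Dset S : Set (ι → ℂ)} {w : ι → ℝ} {ϱ B M : ℝ}
    (hw : ∀ i, 0 < w i) (hϱ : 0 < ϱ) (hA : DifferentiableOn ℂ A Dset) (hB : ∀ Q ∈ Dset, ‖A Q‖ ≤ B)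
    (hS : ∀ P ∈ S, WPolydisc w P ϱ ⊆ Dset) {P P' : ι → ℂ} (hP : P ∈ S) (hP' : P' ∈ S) (hM : 0 ≤ M)
    (hdiff : ∀ i, ‖P i - P' i‖ ≤ w i * M) : ‖A P - A P'‖ ≤ 4 * B / ϱ * M := by
  -- rescaled data
  set g : (ι → ℂ) → F := A ∘ wscale w with hg_def
  have hg : DifferentiableOn ℂ g (wscale w ⁻¹' Dset) :=
    hA.comp (differentiable_wscale w).differentiableOn (mapsTo_preimage _ _)
  have hgB : ∀ z ∈ wscale w ⁻¹' Dset, ‖g z‖ ≤ B := fun z hz => hB _ hz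
  have hmargin : ∀ y ∈ wscale w ⁻¹' S, closedBall y ϱ ⊆ wscale w ⁻¹' Dset := by
    intro y hy z hz
    refine hS _ hy fun i => ?_
    rw [mem_closedBall, dist_eq_norm] at hz
    have hzi : ‖z i - y i‖ ≤ ϱ := (norm_le_pi_norm (z - y) i).trans hz
    calc ‖wscale w z i - wscale w y i‖ = w i * ‖z i - y i‖ := by
            simp only [wscale, ← mul_sub, norm_mul, Complex.norm_real, Real.norm_eq_abs, abs_of_pos (hw i)]
      _ ≤ w i * ϱ := mul_le_mul_of_nonneg_left hzi (hw i).le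
  -- the unscaled points
  set x : ι → ℂ := fun i => P i / w i with hx_def
  set y : ι → ℂ := fun i => P' i / w i with hy_def
  have hxP : wscale w x = P := wscale_unscale hw P
  have hyP : wscale w y = P' := wscale_unscale hw P'
  have hx : x ∈ wscale w ⁻¹' S := by rw [mem_preimage, hxP]; exact hP
  have hy : y ∈ wscale w ⁻¹' S := by rw [mem_preimage, hyP]; exact hP'
  have h := norm_sub_le_of_margin hϱ hg hgB hmargin hx hy
  have hgx : g x = A P := by simp [hg_def, hxP]
  have hgy : g y = A P' := by simp [hg_def, hyP]
  rw [hgx, hgy] at h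
  -- sup distance of the unscaled points ≤ M
  have hxy : ‖x - y‖ ≤ M := by
    refine (pi_norm_le_iff_of_nonneg hM).2 fun i => ?_
    have hwi := hw i
    rw [Pi.sub_apply, hx_def, hy_def]
    dsimp only
    rw [← sub_div, norm_div, Complex.norm_real, Real.norm_eq_abs, abs_of_pos hwi, div_le_iff₀ hwi, mul_comm]
    exact hdiff i
  have hPD : P ∈ Dset := hS P hP fun i => by simp [mul_nonneg (hw i).le hϱ.le]
  have hB0 : 0 ≤ B := (norm_nonneg _).trans (hB P hPD)
  exact h.trans (mul_le_mul_of_nonneg_left hxy (by positivity))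

end WeightedCauchy

/-! ## §3 The output modulus from analyticity in the channel outputs -/

/-- **`OutputLipschitz` FROM ANALYTICITY + SIZE** (the Cauchy pencil in the potentials; binder hypotheses, NOT PRINTED for
Bałaban's objects as functions of the potentials — see the module docstring): if `Ψ k s P U X` is the real part of
`A k s U X` at the real point `P`, where `A k s U X` is complex differentiable with `‖A k s U X‖ ≤ B₀ k·e^{−κ·d(X)}` on a
set containing the weighted polydisc (weights `wt k`, margin `ϱ`) about every output configuration `T k g′ (E g)`
(g, g′ ∈ W) on scale-(k+1) domains, and the output index is nonempty with positive weights, then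
`OutputLipschitz E W T Ψ κ wt (fun k => 4·B₀ k/ϱ)`. [folklore] -/
theorem outputLipschitz_of_analytic {Bg ι : Type} [Fintype ι] [Nonempty ι] {E : Functional C Bg} {W : Set (ℕ → ℝ)}
    {T : ℕ → (ℕ → ℝ) → (Bg → C.Dom → ℝ) → ι → ℝ} {Ψ : ℕ → ℝ → (ι → ℝ) → Bg → C.Dom → ℝ} {κ ϱ : ℝ}
    {wt : ℕ → ι → ℝ} {B₀ : ℕ → ℝ} (A : ℕ → ℝ → Bg → C.Dom → (ι → ℂ) → ℂ) (Dset : ℕ → ℝ → Bg → C.Dom → Set (ι → ℂ))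
    (hwt : ∀ k y, 0 < wt k y) (hϱ : 0 < ϱ)
    (hΨ : ∀ (k : ℕ) (s : ℝ) (P : ι → ℝ) (U : Bg) (X : C.Dom),
      Ψ k s P U X = (A k s U X (fun y => (P y : ℂ))).re)
    (hA : ∀ k s U X, DifferentiableOn ℂ (A k s U X) (Dset k s U X))
    (hB : ∀ k s U X, ∀ Q ∈ Dset k s U X, ‖A k s U X Q‖ ≤ B₀ k * Real.exp (-(κ * C.d X)))
    (hS : ∀ g ∈ W, ∀ g' ∈ W, ∀ (k : ℕ) (U : Bg) (X : C.Dom), C.scale X = k + 1 →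
      WPolydisc (wt k) (fun y => (T k g' (E g) y : ℂ)) ϱ ⊆ Dset k (g' k) U X) :
    OutputLipschitz E W T Ψ κ wt (fun k => 4 * B₀ k / ϱ) := by
  intro g hg g' hg' k M hM U X hX
  -- M ≥ 0 from the hypothesis at some output index
  obtain ⟨y₀⟩ := ‹Nonempty ι›
  have hM0 : 0 ≤ M := by
    have h := (abs_nonneg _).trans (hM y₀)
    exact nonneg_of_mul_nonneg_right (by simpa [mul_comm] using h) (hwt k y₀)
  -- the comparison set: the two output configurations
  set P : ι → ℂ := fun y => (T k g' (E g) y : ℂ) with hP_def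
  set P' : ι → ℂ := fun y => (T k g' (E g') y : ℂ) with hP'_def
  have hSS : ∀ Q ∈ ({P, P'} : Set (ι → ℂ)), WPolydisc (wt k) Q ϱ ⊆ Dset k (g' k) U X := by
    intro Q hQ
    rcases hQ with rfl | hQ
    · exact hS g hg g' hg' k U X hX
    · rw [mem_singleton_iff] at hQ
      subst hQ
      exact hS g' hg' g' hg' k U X hX
  have hdiff : ∀ y, ‖P y - P' y‖ ≤ wt k y * M := fun y => by
    rw [hP_def, hP'_def]
    dsimp only
    rw [← Complex.ofReal_sub, Complex.norm_real, Real.norm_eq_abs]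
    exact hM y
  have h := weightedCauchyLipschitz (hwt k) hϱ (hA k (g' k) U X) (hB k (g' k) U X) hSS
    (mem_insert _ _) (mem_insert_of_mem _ (mem_singleton _)) hM0 hdiff
  rw [hΨ, hΨ]
  calc |(A k (g' k) U X P).re - (A k (g' k) U X P').re|
      = |(A k (g' k) U X P - A k (g' k) U X P').re| := by rw [Complex.sub_re]
    _ ≤ ‖A k (g' k) U X P - A k (g' k) U X P'‖ := Complex.abs_re_le_norm _
    _ ≤ 4 * (B₀ k * Real.exp (-(κ * C.d X))) / ϱ * M := h
    _ = Real.exp (-(κ * C.d X)) * (4 * B₀ k / ϱ * M) := by ring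

/-- **THE OUTER BINDER FROM PRINTED-TYPE DATA**: factorisation + explicit last-coupling modulus + analyticity-and-size of
the new-term map in the channel outputs ⇒ `OuterLipschitz E W T κ wt lam (fun k => 4·B₀ k/ϱ)`; feed it to
`T4HistoryLipschitzRecursion.stepLipschitz_of_linearChannel` / `ne9_and_fadingMemory_of_linearChannel`. [folklore] -/
theorem outerLipschitz_of_analytic {Bg ι : Type} [Fintype ι] [Nonempty ι] {E : Functional C Bg} {W : Set (ℕ → ℝ)}
    {T : ℕ → (ℕ → ℝ) → (Bg → C.Dom → ℝ) → ι → ℝ} {Ψ : ℕ → ℝ → (ι → ℝ) → Bg → C.Dom → ℝ} {κ ϱ : ℝ}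
    {wt : ℕ → ι → ℝ} {lam B₀ : ℕ → ℝ} (A : ℕ → ℝ → Bg → C.Dom → (ι → ℂ) → ℂ)
    (Dset : ℕ → ℝ → Bg → C.Dom → Set (ι → ℂ)) (hfac : Factorises E W T Ψ) (hlast : LastCouplingLipschitz E W T Ψ κ lam)
    (hwt : ∀ k y, 0 < wt k y) (hϱ : 0 < ϱ)
    (hΨ : ∀ (k : ℕ) (s : ℝ) (P : ι → ℝ) (U : Bg) (X : C.Dom),
      Ψ k s P U X = (A k s U X (fun y => (P y : ℂ))).re)
    (hA : ∀ k s U X, DifferentiableOn ℂ (A k s U X) (Dset k s U X))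
    (hB : ∀ k s U X, ∀ Q ∈ Dset k s U X, ‖A k s U X Q‖ ≤ B₀ k * Real.exp (-(κ * C.d X)))
    (hS : ∀ g ∈ W, ∀ g' ∈ W, ∀ (k : ℕ) (U : Bg) (X : C.Dom), C.scale X = k + 1 →
      WPolydisc (wt k) (fun y => (T k g' (E g) y : ℂ)) ϱ ⊆ Dset k (g' k) U X) :
    OuterLipschitz E W T κ wt lam (fun k => 4 * B₀ k / ϱ) :=
  outerLipschitz_of_factorisation hfac hlast (outputLipschitz_of_analytic A Dset hwt hϱ hΨ hA hB hS)

/-! ## §4 (v1.1) The Banach form: any output index, outputs read into a complex normed space -/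

/-- **`OutputLipschitz` FROM ANALYTICITY + SIZE, BANACH FORM** (no finiteness of the output index): `ρ k : (ι → ℝ) → Pot`
reads an output configuration into a complex normed space with `‖ρ k P − ρ k P′‖ ≤ M` whenever `∀ y, |P y − P′ y| ≤ wt k y·M`
(the intended Pot: a weighted sup-norm space; then this is the definition of its norm); `Ψ k s P U X = Re (A k s U X (ρ k P))`
with `A k s U X` complex differentiable and bounded by `B₀ k·e^{−κ·d X}` on `Dset k s U X`, which contains the closed
ϱ-ball about `ρ k (T k g′ (E g))` for all g, g′ ∈ W on scale-(k+1) domains.  Then `OutputLipschitz E W T Ψ κ wt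
(fun k => 4·B₀ k/ϱ)` — `Dimock2015.norm_sub_le_of_margin` on the two-point comparison set. (Binders NOT PRINTED for
Bałaban's objects as functions of the potentials; see the module docstring.) [folklore] -/
theorem outputLipschitz_of_analyticOn_banach {Bg ι : Type} {Pot : Type*} [NormedAddCommGroup Pot] [NormedSpace ℂ Pot]
    {E : Functional C Bg} {W : Set (ℕ → ℝ)} {T : ℕ → (ℕ → ℝ) → (Bg → C.Dom → ℝ) → ι → ℝ}
    {Ψ : ℕ → ℝ → (ι → ℝ) → Bg → C.Dom → ℝ} {κ ϱ : ℝ} {wt : ℕ → ι → ℝ} {B₀ : ℕ → ℝ} (ρ : ℕ → (ι → ℝ) → Pot)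
    (A : ℕ → ℝ → Bg → C.Dom → Pot → ℂ) (Dset : ℕ → ℝ → Bg → C.Dom → Set Pot) (hϱ : 0 < ϱ)
    (hρ : ∀ (k : ℕ) (P P' : ι → ℝ) (M : ℝ), (∀ y, |P y - P' y| ≤ wt k y * M) → ‖ρ k P - ρ k P'‖ ≤ M)
    (hΨ : ∀ (k : ℕ) (s : ℝ) (P : ι → ℝ) (U : Bg) (X : C.Dom), Ψ k s P U X = (A k s U X (ρ k P)).re)
    (hA : ∀ k s U X, DifferentiableOn ℂ (A k s U X) (Dset k s U X))
    (hB : ∀ k s U X, ∀ Q ∈ Dset k s U X, ‖A k s U X Q‖ ≤ B₀ k * Real.exp (-(κ * C.d X)))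
    (hS : ∀ g ∈ W, ∀ g' ∈ W, ∀ (k : ℕ) (U : Bg) (X : C.Dom), C.scale X = k + 1 →
      closedBall (ρ k (T k g' (E g))) ϱ ⊆ Dset k (g' k) U X) :
    OutputLipschitz E W T Ψ κ wt (fun k => 4 * B₀ k / ϱ) := by
  intro g hg g' hg' k M hM U X hX
  set P : Pot := ρ k (T k g' (E g)) with hP_def
  set P' : Pot := ρ k (T k g' (E g')) with hP'_def
  have hPP' : ‖P - P'‖ ≤ M := hρ k _ _ M hM
  have hM0 : 0 ≤ M := (norm_nonneg _).trans hPP'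
  have hSS : ∀ Q ∈ ({P, P'} : Set Pot), closedBall Q ϱ ⊆ Dset k (g' k) U X := by
    intro Q hQ
    rcases hQ with rfl | hQ
    · exact hS g hg g' hg' k U X hX
    · rw [mem_singleton_iff] at hQ
      subst hQ
      exact hS g' hg' g' hg' k U X hX
  have h := norm_sub_le_of_margin hϱ (hA k (g' k) U X) (hB k (g' k) U X) hSS
    (mem_insert _ _) (mem_insert_of_mem _ (mem_singleton _))
  have hB0 : 0 ≤ B₀ k * Real.exp (-(κ * C.d X)) :=
    (norm_nonneg _).trans (hB k (g' k) U X P (hS g hg g' hg' k U X hX (mem_closedBall_self hϱ.le)))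
  rw [hΨ, hΨ]
  calc |(A k (g' k) U X P).re - (A k (g' k) U X P').re|
      = |(A k (g' k) U X P - A k (g' k) U X P').re| := by rw [Complex.sub_re]
    _ ≤ ‖A k (g' k) U X P - A k (g' k) U X P'‖ := Complex.abs_re_le_norm _
    _ ≤ 4 * (B₀ k * Real.exp (-(κ * C.d X))) / ϱ * ‖P - P'‖ := h
    _ ≤ 4 * (B₀ k * Real.exp (-(κ * C.d X))) / ϱ * M := mul_le_mul_of_nonneg_left hPP' (by positivity)
    _ = Real.exp (-(κ * C.d X)) * (4 * B₀ k / ϱ * M) := by ring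

/-- The composed outer binder in the Banach form: `Factorises` + `LastCouplingLipschitz` + the hypotheses of
`outputLipschitz_of_analyticOn_banach` ⇒ `OuterLipschitz E W T κ wt lam (fun k => 4·B₀ k/ϱ)`. [folklore] -/
theorem outerLipschitz_of_analyticOn_banach {Bg ι : Type} {Pot : Type*} [NormedAddCommGroup Pot] [NormedSpace ℂ Pot]
    {E : Functional C Bg} {W : Set (ℕ → ℝ)} {T : ℕ → (ℕ → ℝ) → (Bg → C.Dom → ℝ) → ι → ℝ}
    {Ψ : ℕ → ℝ → (ι → ℝ) → Bg → C.Dom → ℝ} {κ ϱ : ℝ} {wt : ℕ → ι → ℝ} {lam B₀ : ℕ → ℝ} (ρ : ℕ → (ι → ℝ) → Pot)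
    (A : ℕ → ℝ → Bg → C.Dom → Pot → ℂ) (Dset : ℕ → ℝ → Bg → C.Dom → Set Pot) (hfac : Factorises E W T Ψ)
    (hlast : LastCouplingLipschitz E W T Ψ κ lam) (hϱ : 0 < ϱ)
    (hρ : ∀ (k : ℕ) (P P' : ι → ℝ) (M : ℝ), (∀ y, |P y - P' y| ≤ wt k y * M) → ‖ρ k P - ρ k P'‖ ≤ M)
    (hΨ : ∀ (k : ℕ) (s : ℝ) (P : ι → ℝ) (U : Bg) (X : C.Dom), Ψ k s P U X = (A k s U X (ρ k P)).re)
    (hA : ∀ k s U X, DifferentiableOn ℂ (A k s U X) (Dset k s U X))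
    (hB : ∀ k s U X, ∀ Q ∈ Dset k s U X, ‖A k s U X Q‖ ≤ B₀ k * Real.exp (-(κ * C.d X)))
    (hS : ∀ g ∈ W, ∀ g' ∈ W, ∀ (k : ℕ) (U : Bg) (X : C.Dom), C.scale X = k + 1 →
      closedBall (ρ k (T k g' (E g))) ϱ ⊆ Dset k (g' k) U X) :
    OuterLipschitz E W T κ wt lam (fun k => 4 * B₀ k / ϱ) :=
  outerLipschitz_of_factorisation hfac hlast (outputLipschitz_of_analyticOn_banach ρ A Dset hϱ hρ hΨ hA hB hS)

/-! ## §5 (v1.2) The maximal margin: analyticity on a BALL about the origin of the potential space and occurring outputs of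
bounded norm — the outer constant `4B₀/(R − s)`, and the NE9 smallness conditions as LOWER BOUNDS ON THE ANALYTICITY RADIUS -/

/-- **`OutputLipschitz` WITH THE MAXIMAL MARGIN.**  If the new-term map `A k s U X` is complex differentiable and bounded by
`B₀ k·e^{−κd(X)}` on the closed ball of radius `R` about the ORIGIN of the potential space `Pot` (the zero potential = no old
terms; print: the expression under the exponential of (2.13) p. 268 of [Balaban1987RG1] *"vanishes at g_k = 0"*, and the
cluster expansion (2.14)–(2.15) p. 15 of [Balaban1988RG2Cluster] is analytic in the complex parameters τ multiplying the
potentials), and every occurring output configuration — including the hybrid ones `T k g′ (E g)`, g ≠ g′ — has norm at most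
`s < R` (print: the SIZE bound (1.36) p. 9, uniform in the history), then the margin `ϱ = R − s` is available about every
occurring point and §4 gives `OutputLipschitz E W T Ψ κ wt (fun k => 4·B₀ k/(R − s))`.  The outer constant is thus
controlled by the RATIO of the occurring size to the analyticity radius — the shape of every smallness condition in [II]
(p. 18: *"Assuming 2E₀ε₁C₁α₄^{−1}α₆^{−1}M^q exp C₂κ₁ exp 5κ ≤ 1"*, ε₂ of (2.35) p. 19).  Binders NOT PRINTED for Bałaban's
objects as functions of the potentials (module docstring). [cite: Balaban1988RG2Cluster, (2.14)-(2.15) p.15, p.18, (2.35) p.19] -/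
theorem outputLipschitz_of_analyticOn_ball {Bg ι : Type} {Pot : Type*} [NormedAddCommGroup Pot] [NormedSpace ℂ Pot]
    {E : Functional C Bg} {W : Set (ℕ → ℝ)} {T : ℕ → (ℕ → ℝ) → (Bg → C.Dom → ℝ) → ι → ℝ}
    {Ψ : ℕ → ℝ → (ι → ℝ) → Bg → C.Dom → ℝ} {κ s R : ℝ} {wt : ℕ → ι → ℝ} {B₀ : ℕ → ℝ} (ρ : ℕ → (ι → ℝ) → Pot)
    (A : ℕ → ℝ → Bg → C.Dom → Pot → ℂ) (hsR : s < R)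
    (hρ : ∀ (k : ℕ) (P P' : ι → ℝ) (M : ℝ), (∀ y, |P y - P' y| ≤ wt k y * M) → ‖ρ k P - ρ k P'‖ ≤ M)
    (hΨ : ∀ (k : ℕ) (s' : ℝ) (P : ι → ℝ) (U : Bg) (X : C.Dom), Ψ k s' P U X = (A k s' U X (ρ k P)).re)
    (hA : ∀ k s' U X, DifferentiableOn ℂ (A k s' U X) (closedBall (0 : Pot) R))
    (hB : ∀ k s' U X, ∀ Q ∈ closedBall (0 : Pot) R, ‖A k s' U X Q‖ ≤ B₀ k * Real.exp (-(κ * C.d X)))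
    (hocc : ∀ g ∈ W, ∀ g' ∈ W, ∀ k : ℕ, ‖ρ k (T k g' (E g))‖ ≤ s) :
    OutputLipschitz E W T Ψ κ wt (fun k => 4 * B₀ k / (R - s)) :=
  outputLipschitz_of_analyticOn_banach ρ A (fun k _ _ _ => closedBall (0 : Pot) R) (sub_pos.mpr hsR) hρ hΨ
    (fun k s' U X => hA k s' U X) (fun k s' U X => hB k s' U X) fun g hg g' hg' k U X _ =>
      closedBall_subset_closedBall' (by
        rw [dist_zero_right]
        linarith [hocc g hg g' hg' k])

/-- The composed outer binder with the maximal margin: `OuterLipschitz E W T κ wt lam (fun k => 4·B₀ k/(R − s))`. [folklore] -/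
theorem outerLipschitz_of_analyticOn_ball {Bg ι : Type} {Pot : Type*} [NormedAddCommGroup Pot] [NormedSpace ℂ Pot]
    {E : Functional C Bg} {W : Set (ℕ → ℝ)} {T : ℕ → (ℕ → ℝ) → (Bg → C.Dom → ℝ) → ι → ℝ}
    {Ψ : ℕ → ℝ → (ι → ℝ) → Bg → C.Dom → ℝ} {κ s R : ℝ} {wt : ℕ → ι → ℝ} {lam B₀ : ℕ → ℝ} (ρ : ℕ → (ι → ℝ) → Pot)
    (A : ℕ → ℝ → Bg → C.Dom → Pot → ℂ) (hfac : Factorises E W T Ψ) (hlast : LastCouplingLipschitz E W T Ψ κ lam)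
    (hsR : s < R)
    (hρ : ∀ (k : ℕ) (P P' : ι → ℝ) (M : ℝ), (∀ y, |P y - P' y| ≤ wt k y * M) → ‖ρ k P - ρ k P'‖ ≤ M)
    (hΨ : ∀ (k : ℕ) (s' : ℝ) (P : ι → ℝ) (U : Bg) (X : C.Dom), Ψ k s' P U X = (A k s' U X (ρ k P)).re)
    (hA : ∀ k s' U X, DifferentiableOn ℂ (A k s' U X) (closedBall (0 : Pot) R))
    (hB : ∀ k s' U X, ∀ Q ∈ closedBall (0 : Pot) R, ‖A k s' U X Q‖ ≤ B₀ k * Real.exp (-(κ * C.d X)))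
    (hocc : ∀ g ∈ W, ∀ g' ∈ W, ∀ k : ℕ, ‖ρ k (T k g' (E g))‖ ≤ s) :
    OuterLipschitz E W T κ wt lam (fun k => 4 * B₀ k / (R - s)) :=
  outerLipschitz_of_factorisation hfac hlast (outputLipschitz_of_analyticOn_ball ρ A hsR hρ hΨ hA hB hocc)

/-- **NE9-FADE AS A LOWER BOUND ON THE ANALYTICITY RADIUS** (pure algebra, for the §6 rate of
`T4HistoryLipschitzRecursion.ne9_and_fadingMemory_of_linearChannel` with `c̄ = 4B₀/(R − s)`): if the radius exceeds the
occurring size by MORE than `4B₀τ̄/(1 − ω)` — `4B₀τ̄ < (R − s)(1 − ω)` — then `ω + (4B₀/(R − s))·τ̄ < 1`, i.e. the history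
memory FADES.  Under the cell's reading of the units (`wt` ↔ ε₁C₁M^qe^{C₂κ₁}e^{−(1−2δ)κd_k(Y)}, so that `s` ↔ O(1)E₀ by
(1.36) and `τ̄`, `B₀` are ε₁-free while `R` ↔ (a τ-radius of (2.14) of the α₆-type of p. 18)·(ε₁C₁M^qe^{C₂κ₁})^{−1} grows like
ε₁^{−1}), this is an «ε₁ sufficiently small» condition of the printed TYPE — with the same letters as ε₂ of (2.35) — but it
is NOT a printed inequality (cell GAPS G-ne9p2-3). [folklore] -/
theorem fade_of_radius {B₀ τbar ω s R : ℝ} (hsR : s < R) (hR : 4 * B₀ * τbar < (R - s) * (1 - ω)) :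
    ω + 4 * B₀ / (R - s) * τbar < 1 := by
  have h2 : 0 < R - s := sub_pos.mpr hsR
  have h4 : 4 * B₀ / (R - s) * τbar < 1 - ω := by
    rw [div_mul_eq_mul_div, div_lt_iff₀ h2]
    linarith
  linarith

/-- **BOUNDED HISTORY MODULI AS A LOWER BOUND ON THE RADIUS** (pure algebra, for the uniform form of
`T4HistoryLipschitzRecursion` §7, v1.2: moduli `ℓ·max(1, K)^{age}` with `K = c̄·τu`): with `c̄ = 4B₀/(R − s)`, the
non-expansion `K ≤ 1` reads `4B₀τu ≤ R − s` — the radius exceeds the occurring size by the outer bound times the channel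
constant. [folklore] -/
theorem nonexpansive_of_radius {B₀ τu s R : ℝ} (hsR : s < R) (hR : 4 * B₀ * τu ≤ R - s) :
    4 * B₀ / (R - s) * τu ≤ 1 := by
  have h2 : 0 < R - s := sub_pos.mpr hsR
  rw [div_mul_eq_mul_div, div_le_one h2]
  linarith

end Literature.MathematicalPhysics.QuantumFieldTheory.Balaban1983to89.T4HistoryLipschitzOuter

end
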